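import Literature.AnabelianGeometry.SemiGraphs.OfProfiniteGroupsProofs
import Literature.AnabelianGeometry.Anabelioids.BCatFundamentalGroup

/-!
# [SemiAnbd] Remark 2.6.1, II: the pair `(ℍ, 𝕂)` and the discharge of `remark_2_6_1`

Mochizuki, *Semi-graphs of anabelioids*, Publ. RIMS **42** (2006), Remark 2.6.1 p. 29
[cite: MochizukiSemiAnbd2006, Rem. 2.6.1 p.29].  Sequel to `OfProfiniteGroupsProofs` (where
`ρ₀ : B(𝒢) ⥤ B(G)` is shown to be an equivalence, so that `Π_𝒢 = G` and the image of `Π_ℍ` is all of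
`Π_𝒢`).  Here we show that the image of `Π_𝕂 → Π_𝒢` has FINITE index — it contains the image of
`Π_2 = π₁(B(H)) → Π_𝒢 = π₁(B(G))`, which under the dictionary `π₁(B(G)) = G`
(`Anabelioids.exists_continuousMulEquiv_aut_forget`) is the open subgroup `H ⊆ G` — so that the
first clause of the conclusion of Proposition 2.6 ("`[Π_𝒢 : Π_𝕂] = ∞`") fails for `(ℍ, 𝕂)`, and
assemble `remark_2_6_1_holds`.

Generic tools (indices of images of `π₁(φ)` are invariant under isomorphism of the functor, of the
basepoint, and under composition with an equivalence) are proved first.  Proof-only file.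
-/

noncomputable section

namespace Literature.AnabelianGeometry.SemiGraphs

open CategoryTheory CategoryTheory.Limits CategoryTheory.Functor CategoryTheory.PreGaloisCategory
open Literature.AlgebraicGeometry.Frobenioids (BCat)
open Literature.AnabelianGeometry.Anabelioids
open scoped FintypeCatDiscrete

/-! ### Indices of images of `π₁(φ)`: invariance lemmas -/

section Generic

universe v₁ v₂ v₃ u₁ u₂ u₃ w

variable {X : Type u₁} [Category.{v₁} X] {Y : Type u₂} [Category.{v₂} Y] {Z : Type u₃}
  [Category.{v₃} Z]

/-- Isomorphic functors `Q ≅ Q'` induce conjugate homomorphisms `π₁(Q), π₁(Q')`, so their images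
have the same index ([GeoAn] Def. 1.1.2 (ii): `π₁` is well defined up to conjugation).
[cite: MochizukiGeoAn2004, Def. 1.1.2(ii) p.10] -/
theorem index_range_pi1Map_congr {Q Q' : Y ⥤ X} (ν : Q ≅ Q') (F : X ⥤ FintypeCat.{w}) :
    (pi1Map Q F).range.index = (pi1Map Q' F).range.index := by
  have key : ∀ σ : Aut F, (isoWhiskerRight ν F).conjAut (pi1Map Q F σ) = pi1Map Q' F σ := by
    intro σ
    apply Iso.ext
    apply NatTrans.ext
    funext b
    simp only [Iso.conjAut_hom, Iso.conj_apply, NatTrans.comp_app, isoWhiskerRight_inv,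
      isoWhiskerRight_hom, whiskerRight_app, pi1Map_hom_app]
    have nat := σ.hom.naturality (ν.hom.app b)
    change F.map (ν.inv.app b) ≫ σ.hom.app (Q.obj b) ≫ F.map (ν.hom.app b) = σ.hom.app (Q'.obj b)
    change F.map (ν.hom.app b) ≫ σ.hom.app (Q'.obj b) = σ.hom.app (Q.obj b) ≫ F.map (ν.hom.app b)
      at nat
    rw [← nat, ← Category.assoc, ← F.map_comp, Iso.inv_hom_id_app, F.map_id, Category.id_comp]
  have hr : (pi1Map Q' F).range = (pi1Map Q F).range.map (isoWhiskerRight ν F).conjAut.toMonoidHom := by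
    ext τ
    simp only [MonoidHom.mem_range, Subgroup.mem_map]
    constructor
    · rintro ⟨σ, rfl⟩
      exact ⟨pi1Map Q F σ, ⟨σ, rfl⟩, key σ⟩
    · rintro ⟨_, ⟨σ, rfl⟩, rfl⟩
      exact ⟨σ, (key σ).symm⟩
  rw [hr, Subgroup.index_map_of_bijective (MulEquiv.bijective _)]

/-- Precomposing with an equivalence of categories does not change the index of the image of
`π₁(R)`: `π₁(P ⋙ R) = π₁(P) ∘ π₁(R)` with `π₁(P)` bijective.
[cite: MochizukiGeoAn2004, Def. 1.1.2(i) p.10] -/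
theorem index_range_pi1Map_equivalence_comp (P : Y ⥤ X) [P.IsEquivalence] (R : X ⥤ Z)
    (F : Z ⥤ FintypeCat.{w}) :
    (pi1Map (P ⋙ R) F).range.index = (pi1Map R F).range.index := by
  have h : ∀ σ : Aut F, pi1Map (P ⋙ R) F σ = pi1Map P (R ⋙ F) (pi1Map R F σ) := fun σ => rfl
  have hr : (pi1Map (P ⋙ R) F).range = (pi1Map R F).range.map (pi1Map P (R ⋙ F)) := by
    ext τ
    simp only [MonoidHom.mem_range]
    constructor
    · rintro ⟨σ, rfl⟩
      exact ⟨pi1Map R F σ, ⟨σ, rfl⟩, (h σ).symm⟩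
    · rintro ⟨_, ⟨σ, rfl⟩, rfl⟩
      exact ⟨σ, h σ⟩
  rw [hr]
  exact Subgroup.index_map_of_bijective (pi1Map_bijective_of_isEquivalence P (R ⋙ F)) _

/-- Changing the basepoint along an isomorphism `F ≅ F'` conjugates `π₁(P)` (`pi1Map_conjAut`), so
the index of its image is unchanged. [cite: MochizukiGeoAn2004, Def. 1.1.2(ii) p.10] -/
theorem index_range_pi1Map_eq_of_iso (P : Y ⥤ X) {F F' : X ⥤ FintypeCat.{v₁}} (e : F ≅ F') :
    (pi1Map P F).range.index = (pi1Map P F').range.index := by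
  have key : ∀ σ : Aut F, (isoWhiskerLeft P e).conjAut (pi1Map P F σ) = pi1Map P F' (e.conjAut σ) :=
    fun σ => (pi1Map_conjAut P e σ).symm
  have hr : (pi1Map P F').range = (pi1Map P F).range.map (isoWhiskerLeft P e).conjAut.toMonoidHom := by
    ext τ
    simp only [MonoidHom.mem_range, Subgroup.mem_map]
    constructor
    · rintro ⟨σ', rfl⟩
      refine ⟨pi1Map P F (e.conjAut.symm σ'), ⟨_, rfl⟩, ?_⟩
      rw [MulEquiv.coe_toMonoidHom, key, MulEquiv.apply_symm_apply]
    · rintro ⟨_, ⟨σ, rfl⟩, rfl⟩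
      exact ⟨e.conjAut σ, (key σ).symm⟩
  rw [hr, Subgroup.index_map_of_bijective (MulEquiv.bijective _)]

end Generic

/-! ### The forgetful basepoint of `B(K)` and the image of `π₁(B(K)) → π₁(B(L))` -/

section Forget

universe u

/-- The forgetful functor of `B(K)` is a fibre functor (the basepoint exhibited in the proof of
`Anabelioids.galoisCategory_bCat`, recorded as a statement; private twin of the bridge file's
`Anabelioids.fiberFunctor_forget_bCat`). [cite: MochizukiGeoAn2004, §1.1 p.9] -/
private theorem fiberFunctor_forget_bCat (K : Type u) [Group K] [TopologicalSpace K] [IsTopologicalGroup K] :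
    letI := galoisCategory_bCat K
    FiberFunctor (ObjectProperty.ι (Action.IsContinuous (V := FintypeCat.{u}) (G := K)) ⋙
      Action.forget FintypeCat.{u} K) := by
  haveI hlim : ∀ (J : Type) [SmallCategory J] [FinCategory J],
      ObjectProperty.IsClosedUnderLimitsOfShape
        (Action.IsContinuous (V := FintypeCat.{u}) (G := K)) J :=
    fun J _ _ => isClosedUnderLimitsOfShape_isContinuous J
  haveI hcolim : ∀ (J : Type) [SmallCategory J] [FinCategory J],
      ObjectProperty.IsClosedUnderColimitsOfShape
        (Action.IsContinuous (V := FintypeCat.{u}) (G := K)) J :=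
    fun J _ _ => isClosedUnderColimitsOfShape_isContinuous J
  haveI : ∀ (J : Type) [SmallCategory J] [FinCategory J], HasLimitsOfShape J (BCat K) :=
    fun J _ _ => hasLimitsOfShape_of_closedUnderLimits J _
  haveI : ∀ (J : Type) [SmallCategory J] [FinCategory J], HasColimitsOfShape J (BCat K) :=
    fun J _ _ => hasColimitsOfShape_of_closedUnderColimits J _
  letI := galoisCategory_bCat K
  haveI : ∀ (J : Type) [SmallCategory J] [FinCategory J], PreservesLimitsOfShape J
      (ObjectProperty.ι (Action.IsContinuous (V := FintypeCat.{u}) (G := K)) ⋙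
        Action.forget FintypeCat.{u} K) :=
    fun J _ _ => inferInstance
  haveI : ∀ (J : Type) [SmallCategory J] [FinCategory J], PreservesColimitsOfShape J
      (ObjectProperty.ι (Action.IsContinuous (V := FintypeCat.{u}) (G := K)) ⋙
        Action.forget FintypeCat.{u} K) :=
    fun J _ _ => inferInstance
  exact
    { preservesTerminalObjects := inferInstance
      preservesPullbacks := inferInstance
      preservesFiniteCoproducts := ⟨fun _ => inferInstance⟩
      preservesEpis := inferInstance
      preservesQuotientsByFiniteGroups := fun H _ _ => by
        obtain ⟨H', _, _, ⟨e⟩⟩ :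
            ∃ (H' : Type) (_ : Group H') (_ : Fintype H'), Nonempty (H ≃* H') :=
          Finite.exists_type_univ_nonempty_mulEquiv H
        exact preservesColimitsOfShape_of_equiv e.toSingleObjEquiv.symm _
      reflectsIsos := ⟨fun f hf => by
        haveI : IsIso f.hom.hom := hf
        haveI : IsIso f.hom := inferInstance
        exact (ObjectProperty.isIso_hom_iff f).mp this⟩ }

variable {K L : Type u} [Group K] [TopologicalSpace K] [IsTopologicalGroup K]
  [Group L] [TopologicalSpace L] [IsTopologicalGroup L]

omit [IsTopologicalGroup K] in
/-- For a continuous homomorphism `φ : K → L` into a profinite group, the image of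
`π₁(res φ) : π₁(B(K), forget) → π₁(B(L), forget)` contains (under `π₁(B(L)) = L`) the subgroup
`φ(K)`; in particular its index divides `[L : φ(K)]`.
[cite: MochizukiGeoAn2004, Rem. 1.2.2.1 p.17] -/
theorem index_range_pi1Map_res_dvd [CompactSpace L] [T2Space L] [TotallyDisconnectedSpace L]
    (φ : K →ₜ* L) :
    (pi1Map (ContAction.res FintypeCat.{u} φ)
        (ObjectProperty.ι (Action.IsContinuous (V := FintypeCat.{u}) (G := K)) ⋙
          Action.forget FintypeCat.{u} K)).range.index ∣ φ.toMonoidHom.range.index := by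
  classical
  obtain ⟨e, he⟩ := exists_continuousMulEquiv_aut_forget (G := L)
  -- the action homomorphism of `L` on the composite basepoint `res φ ⋙ forget_K` (`= forget_L`)
  let act : L → Aut (ContAction.res FintypeCat.{u} φ ⋙
      (ObjectProperty.ι (Action.IsContinuous (V := FintypeCat.{u}) (G := K)) ⋙
        Action.forget FintypeCat.{u} K)) := fun l =>
    NatIso.ofComponents (fun X => Action.ρAut X.obj l) (fun {X Y} f => (f.hom.comm l).symm)
  have hact : ∀ (l : L) (X : BCat L), (act l).hom.app X = X.obj.ρ l := fun l X => rfl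
  let ρ' : L →* Aut (ContAction.res FintypeCat.{u} φ ⋙
      (ObjectProperty.ι (Action.IsContinuous (V := FintypeCat.{u}) (G := K)) ⋙
        Action.forget FintypeCat.{u} K)) :=
    { toFun := act
      map_one' := by
        apply Iso.ext
        apply NatTrans.ext
        funext X
        change X.obj.ρ 1 = 𝟙 _
        rw [map_one]
        rfl
      map_mul' := fun g h => by
        apply Iso.ext
        apply NatTrans.ext
        funext X
        change X.obj.ρ (g * h) = X.obj.ρ h ≫ X.obj.ρ g
        rw [map_mul]
        rfl }
  have hρ' : ∀ (l : L) (X : BCat L), (ρ' l).hom.app X = X.obj.ρ l := fun l X => rfl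
  -- `ρ'` is surjective: an automorphism of the composite basepoint is an automorphism of `forget_L`
  have hsurj : Function.Surjective ρ' := by
    intro τ
    let τ' : Aut (ObjectProperty.ι (Action.IsContinuous (V := FintypeCat.{u}) (G := L)) ⋙
        Action.forget FintypeCat.{u} L) :=
      NatIso.ofComponents (fun X => τ.app X) (fun {X Y} f => τ.hom.naturality f)
    obtain ⟨l, hl⟩ := e.surjective τ'
    refine ⟨l, ?_⟩
    apply Iso.ext
    apply NatTrans.ext
    funext X
    rw [hρ', ← he l X, hl]
    rfl
  -- the image of `π₁(res φ)` contains `ρ'(φ(K))`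
  have hle : φ.toMonoidHom.range.map ρ' ≤ (pi1Map (ContAction.res FintypeCat.{u} φ)
      (ObjectProperty.ι (Action.IsContinuous (V := FintypeCat.{u}) (G := K)) ⋙
        Action.forget FintypeCat.{u} K)).range := by
    rintro _ ⟨_, ⟨k, rfl⟩, rfl⟩
    let σ : Aut (ObjectProperty.ι (Action.IsContinuous (V := FintypeCat.{u}) (G := K)) ⋙
        Action.forget FintypeCat.{u} K) :=
      NatIso.ofComponents (fun Y => Action.ρAut Y.obj k) (fun {X Y} f => (f.hom.comm k).symm)
    refine ⟨σ, ?_⟩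
    apply Iso.ext
    apply NatTrans.ext
    funext X
    rw [pi1Map_res_app φ σ k (fun Y => rfl) X, hρ']
    rfl
  exact (Subgroup.index_dvd_of_le hle).trans (Subgroup.index_map_dvd _ hsurj)

end Forget

/-! ### Remark 2.6.1 for the pair `(ℍ, 𝕂)` and the discharge -/

section Remark261

variable {G : Type} [Group G] [TopologicalSpace G] [IsTopologicalGroup G] (H : Subgroup G)

/-- **The image of `Π_2 = π₁(B(H)) → Π_𝒢` has finite index** (Remark 2.6.1: "`Π_𝒢 ≅ G`" and `Π_2 = H`
is open in `G`): for every basepoint `F'` of `B(H)` at the vertex `1` (index `2` in the paper), the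
image of `piVToPi 1 F'` has nonzero (i.e. finite) index. [cite: MochizukiSemiAnbd2006, Rem. 2.6.1 p.29] -/
theorem remark261_index_range_piVToPi_one_ne_zero [CompactSpace G] [T2Space G]
    [TotallyDisconnectedSpace G] (hH : IsOpen (H : Set G))
    (F' : (remark261Groups H).toAnabelioids.V (1 : Fin 3) ⥤ FintypeCat.{0}) [FiberFunctor F'] :
    ((remark261Groups H).toAnabelioids.piVToPi (1 : Fin 3) F').range.index ≠ 0 := by
  -- the inclusion `H ↪ G (= ⊤)` between the vertex groups at `1` and `0`, and restriction along it
  let φ : (remark261Groups H).GV (1 : Fin 3) →ₜ* (remark261Groups H).GV (0 : Fin 3) :=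
    (remark261Groups H).hom ((0 : Fin 2), false) (0 : Fin 3) rfl
  let R : (remark261Groups H).toAnabelioids.V (0 : Fin 3) ⥤ (remark261Groups H).toAnabelioids.V (1 : Fin 3) :=
    ContAction.res FintypeCat.{0} φ
  -- Step 1: `ρ₁ ≅ ρ₀ ⋙ res` (via the two gluing isomorphisms of the first edge); `ρ₀` is an equivalence
  obtain ⟨ν⟩ : Nonempty ((remark261Groups H).toAnabelioids.ρ (1 : Fin 3) ≅
      (remark261Groups H).toAnabelioids.ρ (0 : Fin 3) ⋙ R) :=
    ⟨NatIso.ofComponents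
      (fun A =>
        (show ((remark261Groups H).toAnabelioids.ρ (1 : Fin 3)).obj A ≅
            ((remark261Groups H).toAnabelioids.ρE (0 : Fin 2)).obj A from
          A.ψ ((0 : Fin 2), true) (1 : Fin 3) rfl) ≪≫
        (show ((remark261Groups H).toAnabelioids.ρ (0 : Fin 3) ⋙ R).obj A ≅
            ((remark261Groups H).toAnabelioids.ρE (0 : Fin 2)).obj A from
          A.ψ ((0 : Fin 2), false) (0 : Fin 3) rfl).symm)
      (fun {A B} f => by
        have h1 := f.comm ((0 : Fin 2), true) (1 : Fin 3) rfl
        have h0 := f.comm ((0 : Fin 2), false) (0 : Fin 3) rfl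
        change f.fS (1 : Fin 3) ≫ (B.ψ ((0 : Fin 2), true) (1 : Fin 3) rfl).hom ≫
            (B.ψ ((0 : Fin 2), false) (0 : Fin 3) rfl).inv =
          ((A.ψ ((0 : Fin 2), true) (1 : Fin 3) rfl).hom ≫
              (A.ψ ((0 : Fin 2), false) (0 : Fin 3) rfl).inv) ≫
            ((remark261Groups H).toAnabelioids.pull ((0 : Fin 2), false) (0 : Fin 3) rfl).pullback.map
              (f.fS (0 : Fin 3))
        erw [reassoc_of% h1, Category.assoc]
        congr 1
        rw [Iso.eq_inv_comp, ← Category.assoc]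
        erw [← h0, Category.assoc, Iso.hom_inv_id]
        erw [Category.comp_id])⟩
  have h1 := index_range_pi1Map_congr ν F'
  haveI := remark261_isEquivalence H
  have h2 := index_range_pi1Map_equivalence_comp ((remark261Groups H).toAnabelioids.ρ (0 : Fin 3)) R F'
  -- Step 2: change the basepoint of `B(H)` to the forgetful functor
  haveI hforget : FiberFunctor
      (ObjectProperty.ι (Action.IsContinuous (V := FintypeCat.{0})
          (G := (remark261Groups H).GV (1 : Fin 3))) ⋙
        Action.forget FintypeCat.{0} ((remark261Groups H).GV (1 : Fin 3)) :
        (remark261Groups H).toAnabelioids.V (1 : Fin 3) ⥤ FintypeCat.{0}) :=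
    fiberFunctor_forget_bCat ((remark261Groups H).GV (1 : Fin 3))
  obtain ⟨e⟩ := nonempty_iso_of_fiberFunctor F'
    (ObjectProperty.ι (Action.IsContinuous (V := FintypeCat.{0})
          (G := (remark261Groups H).GV (1 : Fin 3))) ⋙
        Action.forget FintypeCat.{0} ((remark261Groups H).GV (1 : Fin 3)) :
        (remark261Groups H).toAnabelioids.V (1 : Fin 3) ⥤ FintypeCat.{0})
  have h3 := index_range_pi1Map_eq_of_iso R e
  -- Step 3: the dictionary `π₁(B(G)) = G`, under which the image contains `H`
  haveI : CompactSpace ((remark261Groups H).GV (0 : Fin 3)) :=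
    isCompact_iff_compactSpace.mp
      (show IsCompact ((⊤ : Subgroup G) : Set G) by rw [Subgroup.coe_top]; exact isCompact_univ)
  haveI : T2Space ((remark261Groups H).GV (0 : Fin 3)) := inferInstanceAs (T2Space (⊤ : Subgroup G))
  haveI : TotallyDisconnectedSpace ((remark261Groups H).GV (0 : Fin 3)) :=
    inferInstanceAs (TotallyDisconnectedSpace (⊤ : Subgroup G))
  have hdvd := index_range_pi1Map_res_dvd (K := (remark261Groups H).GV (1 : Fin 3))
    (L := (remark261Groups H).GV (0 : Fin 3)) φ
  have hidx : φ.toMonoidHom.range.index = H.index := by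
    change (Subgroup.inclusion (le_remark261VertexSubgroup H 0)).range.index = H.index
    rw [Subgroup.inclusion_range]
    change H.relIndex ⊤ = H.index
    exact Subgroup.relIndex_top_right (H := H)
  haveI : Finite (G ⧸ H) := Subgroup.quotient_finite_of_isOpen H hH
  have hne : φ.toMonoidHom.range.index ≠ 0 := by
    rw [hidx]
    exact Subgroup.index_ne_zero_of_finite (G := G) (H := H)
  intro h0
  exact ne_zero_of_dvd_ne_zero hne hdvd ((h1.trans (h2.trans h3)).symm.trans h0)

/-- **Second conjunct of Remark 2.6.1, first half** — DISCHARGED: the conclusion of Proposition 2.6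
fails for the pair `(ℍ, 𝕂)`: the image of `Π_ℍ` is all of `Π_𝒢` and the image of `Π_𝕂` contains the
finite-index image of `Π_2 = H`, so `[Π_𝒢 : Π_𝕂] < ∞`. [cite: MochizukiSemiAnbd2006, Rem. 2.6.1 p.29] -/
theorem remark261_not_prop26Conclusion_HK [CompactSpace G] [T2Space G] [TotallyDisconnectedSpace G]
    (hH : IsOpen (H : Set G))
    (F : (remark261Groups H).toAnabelioids.V (0 : Fin 3) ⥤ FintypeCat.{0})
    (F' : (remark261Groups H).toAnabelioids.V (1 : Fin 3) ⥤ FintypeCat.{0}) [FiberFunctor F']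
    (α : (remark261Groups H).toAnabelioids.ρ (1 : Fin 3) ⋙ F' ≅
      (remark261Groups H).toAnabelioids.ρ (0 : Fin 3) ⋙ F) :
    ¬ Prop26Conclusion (remark261Groups H).toAnabelioids remark261H remark261K
        ⟨(0 : Fin 3), rfl⟩ F ⟨(1 : Fin 3), Or.inl rfl⟩ F' α := by
  intro h
  obtain ⟨h1, -⟩ := h
  have h2 := h1 1
  rw [map_one, one_smul, remark261_range_piHToPi_H, Subgroup.relIndex_top_right] at h2
  have hle : ((remark261Groups H).toAnabelioids.piVToPi (1 : Fin 3) F').range.map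
        (Aut.autMulEquivOfIso α).toMonoidHom ≤
      ((Aut.autMulEquivOfIso α).toMonoidHom.comp
        ((remark261Groups H).toAnabelioids.piHToPi remark261K ⟨(1 : Fin 3), Or.inl rfl⟩ F')).range := by
    rintro _ ⟨_, ⟨σ, rfl⟩, rfl⟩
    refine ⟨pi1Map (((remark261Groups H).toAnabelioids.restrict remark261K).ρ
      ⟨(1 : Fin 3), Or.inl rfl⟩) F' σ, ?_⟩
    rw [MonoidHom.comp_apply]
    congr 1
  have hdvd := Subgroup.index_dvd_of_le hle
  rw [h2, Subgroup.index_map_of_bijective (MulEquiv.bijective _), zero_dvd_iff] at hdvd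
  exact remark261_index_range_piVToPi_one_ne_zero H hH F' hdvd

omit H in
/-- NAMED FACT `remark_2_6_1` ([SemiAnbd] Remark 2.6.1 p. 29) — DISCHARGED: for a profinite `G` with an
open subgroup `H` and the graph of anabelioids `B(G) — B(H) — B(H)`, `Π_1 → Π_𝒢` is bijective and the
conclusion of Proposition 2.6 fails for `(ℍ, 𝕂)` and for `(𝕂, ℍ)`, for all basepoints and transports.
[cite: MochizukiSemiAnbd2006, Rem. 2.6.1 p.29] -/
theorem remark_2_6_1_holds : remark_2_6_1 := by
  intro G _ _ _ _ _ _ H hH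
  refine ⟨fun F _ => remark261_piVToPi_bijective H F, fun F _ F' _ α β => ⟨?_, ?_⟩⟩
  · exact remark261_not_prop26Conclusion_HK H hH F F' α
  · exact remark261_not_prop26Conclusion_KH H F F' β

end Remark261

end Literature.AnabelianGeometry.SemiGraphs

end
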